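import Mathlib
import Summits.NavierStokesRegularity.NavierStokesRegularity.Theorems.SubOnsagerCeilingKPExitSprayFlux
import Summits.NavierStokesRegularity.NavierStokesRegularity.Theorems.SubOnsagerCeilingKPBarrierCurrency
import Summits.NavierStokesRegularity.NavierStokesRegularity.Theorems.SubcriticalEnvelopeForwardSourceTailEnvelopeKPDyadicRatioTwo
import HarnessLib

/-!
# The ν-uniform shell barrier of the EXIT-SPRAY CLASS at every scale ratio (energy starvation by dead-end exits of both kinds, part 3 of 3)
# (helper file for the crux `SubOnsagerCeiling.ForwardTailCeilingKP`, stmt-NavierStokesRegularity-27057, `--supports`)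

Sequel of `Theorems/SubOnsagerCeilingKPExitSpray{Starvation,Flux}.lean` (the class: Katz–Pavlović chain `W 0 > 0` on component `0`,
diagonal LEAKS `W e ≥ 0` and in-shell PUMPS `P e ≥ 0` (`P 0 = 0`) from the chain into the dead ends `e ≠ 0`; the mechanism:
geometric starvation of the chain fluxes, `Φ_{m+2} ≤ Φ_{m+1}/(1+r)`, `r = (W 1² + W 2² + W 3² + P 1² + P 2² + P 3²)/W 0²`).  It
UNIFIES the two starvation corners landed before it (`deadEndPump_*`: one pump, no leak; `leakSpray_*`: leaks, no pump) and covers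
mixed exits: dead-end exits of both kinds ADD UP in `r`.

* `exitSpray_shellBarrierAt` — `ShellBarrierAt R ε₀ α` with `(1+ε₀)^{2θ} = 1 + r` (`θ > 1/2` iff `Σ_{e≠0}(W e² + P e²) > ε₀·W 0²`),
  `D = (1+r)²`, at EVERY scale ratio `1 + ε₀ > 1`;
* `exitSpray_ceilingAt`, `exitSpray_primaryGraded` — the corner in the currencies `CeilingAt` and the body of the skeleton's
  `PrimaryGradedAt` (verbatim; a corner of BOTH registered stubs `stub_primaryGradedLargeRatio` / `stub_primaryGradedSmallRatio`).

HONEST FRAMING: statements about Tao-type MODEL lattice ODEs (route SubOnsagerCeiling, rung TL-M2Break); one architecture class;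
no stub, crux or summit is proved and nothing here bears on Navier–Stokes regularity. [cite: Tao2016AveragedNS, §4 (4.2)–(4.3), (4.13)]
-/

noncomputable section

-- the sub-problem namespace `NavierStokesRegularity.NavierStokesRegularity` is the tree's layout (D-0017)
set_option linter.dupNamespace false

namespace Summit.NavierStokesRegularity.NavierStokesRegularity.Theorems

open Set Finset MeasureTheory intervalIntegral
open scoped Topology
open Literature.Analysis.FluidPDE.TaoCascade
open Summit.NavierStokesRegularity.NavierStokesRegularity.Theorems.SubOnsagerCeiling

/-- **ENERGY STARVATION BARRIER (exits of both kinds).**  For every KP network proper `α ∈ E₂(R)` of the exit-spray class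
(`α a a i (0,0,1) = [a = 0]·W i`, pumps `α 0 0 c (0,0,0) = P c` from the chain only, no differential triads; `W, P ≥ 0`,
`W 0 > 0`, `P 0 = 0`) with `Σ_{e≠0}(W e² + P e²) > ε₀·W 0²`, at EVERY scale ratio `1 + ε₀ > 1`: `ShellBarrierAt R ε₀ α` with
`(1+ε₀)^{2θ} = 1 + r`, `r = (W 1² + W 2² + W 3² + P 1² + P 2² + P 3²)/W 0²`, and `D = (1+r)²` — uniformly in `ν`, `(1+ε₀)^{2θk}·½X_{i,k}(t)² ≤ (1+r)²·E₀` for all `i`, `k`, `t ∈ [0,s]`.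
MODEL lattice statement; a corner of the registered stubs, not the stubs. [cite: Tao2016AveragedNS, §4 (4.13)] -/
theorem exitSpray_shellBarrierAt {α : Fin 4 → Fin 4 → Fin 4 → ℤ × ℤ × ℤ → ℝ} {W P : Fin 4 → ℝ} {ε₀ : ℝ}
    (hε : 0 < ε₀) (hW0 : 0 < W 0) (hWnn : ∀ i, 0 ≤ W i) (hPnn : ∀ i, 0 ≤ P i) (hgap : ε₀ * W 0 ^ 2 < W 1 ^ 2 + W 2 ^ 2 + W 3 ^ 2 + P 1 ^ 2 + P 2 ^ 2 + P 3 ^ 2)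
    (hD : ∀ a b i : Fin 4, a ≠ b → α a b i (0, 0, 1) = 0)
    (hW : ∀ a i : Fin 4, α a a i (0, 0, 1) = if a = 0 then W i else 0)
    (hP : ∀ a c : Fin 4, a ≠ c → α a a c (0, 0, 0) = if a = 0 then P c else 0) (hP0 : P 0 = 0)
    (hCz : ∀ a b c : Fin 4, a ≠ b → a ≠ c → b ≠ c → α a b c (0, 0, 0) = 0) (R : ℝ) :
    ShellBarrierAt R ε₀ α := by
  intro hT hO
  have hs : IsSymmetricCoeff α := hT.1
  have hc : IsCancellingCoeff α := hT.2.1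
  set r : ℝ := (W 1 ^ 2 + W 2 ^ 2 + W 3 ^ 2 + P 1 ^ 2 + P 2 ^ 2 + P 3 ^ 2) / W 0 ^ 2 with hr
  have hr0 : 0 < 1 + r := by positivity
  have hb1 : (1 : ℝ) < 1 + ε₀ := by linarith
  have hb0 : (0 : ℝ) < 1 + ε₀ := by linarith
  have hrb : 1 + ε₀ < 1 + r := by
    have : ε₀ < (W 1 ^ 2 + W 2 ^ 2 + W 3 ^ 2 + P 1 ^ 2 + P 2 ^ 2 + P 3 ^ 2) / W 0 ^ 2 := by
      rw [lt_div_iff₀ (by positivity)]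
      exact hgap
    simp only [hr]
    linarith
  set θ : ℝ := Real.logb (1 + ε₀) (1 + r) / 2 with hθ
  have hθhalf : 1 / 2 < θ := by
    have : 1 < Real.logb (1 + ε₀) (1 + r) := by
      rw [Real.lt_logb_iff_rpow_lt hb1 hr0, Real.rpow_one]
      exact hrb
    simp only [hθ]
    linarith
  have hpow : (1 + ε₀) ^ (2 * θ) = 1 + r := by
    have : 2 * θ = Real.logb (1 + ε₀) (1 + r) := by simp only [hθ]; ring
    rw [this, Real.rpow_logb hb0 hb1.ne' hr0]
  refine ⟨θ, hθhalf, (1 + r) ^ 2, by positivity, ?_⟩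
  intro ν hν X₀ s _hs X hX0 hXneg _hM hXc hXd hXpos t ht i k
  set E₀ : ℝ := ∑ j : Fin 4, (1 / 2 : ℝ) * X₀ j ^ 2 with hE₀
  have hE₀0 : 0 ≤ E₀ := Finset.sum_nonneg fun j _ => by positivity
  have hq1 : (1 + r) * (1 + r)⁻¹ = 1 := mul_inv_cancel₀ hr0.ne'
  -- the gate fluxes are starved: `∫₀ᵗ gate_m ≤ E₀ (1+r) q^m`
  have hgate : ∀ m : ℕ, ∫ τ in (0 : ℝ)..t, (1 + ε₀) ^ ((5 : ℝ) * (m : ℝ) / 2) *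
      (X 0 (m : ℤ) τ ^ 2 * ∑ j, W j * X j ((m : ℤ) + 1) τ) ≤ E₀ * (1 + r) * ((1 + r)⁻¹) ^ m := by
    intro m
    cases m with
    | zero =>
      have h := kpProper_bondFlux_budget hs hc hO hD hb0 hν.le hX0 hXneg hXc hXd 0 t ht
      simp only [leakSpray_gateFlux hW] at h
      have h1 : E₀ ≤ E₀ * (1 + r) * ((1 + r)⁻¹) ^ 0 := by
        rw [pow_zero, mul_one]
        nlinarith
      exact h.trans h1
    | succ m =>
      have hout := exitSpray_outflux_le_influx hs hc hO hD hW hP hP0 hCz hε.le hν.le hX0 hXc hXd m t ht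
      have hflux := exitSpray_flux_le hs hc hO hD hW hP hP0 hCz hε.le hν.le hW0 hWnn hPnn hX0 hXneg hXc hXd hXpos m t ht
      have hcast1 : (((m + 1 : ℕ) : ℝ)) = (m : ℝ) + 1 := by push_cast; ring
      have hcast2 : (((m + 1 : ℕ) : ℤ)) = (m : ℤ) + 1 := by push_cast; ring
      have hcast3 : ((m : ℤ) + 1 + 1) = (m : ℤ) + 2 := by ring
      rw [hcast1, hcast2, hcast3]
      have heq : E₀ * ((1 + r)⁻¹) ^ m = E₀ * (1 + r) * ((1 + r)⁻¹) ^ (m + 1) := by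
        rw [pow_succ, show E₀ * (1 + r) * (((1 + r)⁻¹) ^ m * (1 + r)⁻¹) =
          E₀ * ((1 + r)⁻¹) ^ m * ((1 + r) * (1 + r)⁻¹) by ring, hq1, mul_one]
      -- the gate flux (chain + leaks) is at most the total drain work (chain + leaks + pumps)
      have hc1 : Continuous fun τ => (1 + ε₀) ^ ((5 : ℝ) * ((m : ℝ) + 1) / 2) *
          (X 0 ((m : ℤ) + 1) τ ^ 2 * ∑ j, W j * X j ((m : ℤ) + 2) τ) :=
        continuous_const.mul (((hXc 0 _).pow 2).mul (continuous_finsetSum _ fun j _ => continuous_const.mul (hXc j _)))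
      have hc2 : Continuous fun τ => (1 + ε₀) ^ ((5 : ℝ) * ((m : ℝ) + 1) / 2) *
          (X 0 ((m : ℤ) + 1) τ ^ 2 * (∑ j, W j * X j ((m : ℤ) + 2) τ + ∑ b, P b * X b ((m : ℤ) + 1) τ)) :=
        continuous_const.mul (((hXc 0 _).pow 2).mul
          ((continuous_finsetSum _ fun j _ => continuous_const.mul (hXc j _)).add
            (continuous_finsetSum _ fun j _ => continuous_const.mul (hXc j _))))
      have hmono : ∫ τ in (0 : ℝ)..t, (1 + ε₀) ^ ((5 : ℝ) * ((m : ℝ) + 1) / 2) *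
            (X 0 ((m : ℤ) + 1) τ ^ 2 * ∑ j, W j * X j ((m : ℤ) + 2) τ) ≤
          ∫ τ in (0 : ℝ)..t, (1 + ε₀) ^ ((5 : ℝ) * ((m : ℝ) + 1) / 2) *
            (X 0 ((m : ℤ) + 1) τ ^ 2 * (∑ j, W j * X j ((m : ℤ) + 2) τ + ∑ b, P b * X b ((m : ℤ) + 1) τ)) := by
        refine intervalIntegral.integral_mono_on ht.1 (hc1.intervalIntegrable _ _) (hc2.intervalIntegrable _ _)
          fun τ hτ => ?_
        have hτs : τ ∈ Icc (0 : ℝ) s := ⟨hτ.1, hτ.2.trans ht.2⟩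
        have hPs : 0 ≤ ∑ b, P b * X b ((m : ℤ) + 1) τ :=
          Finset.sum_nonneg fun b _ => mul_nonneg (hPnn b) (hXpos τ hτs b _ (by omega))
        have hΛ : 0 ≤ (1 + ε₀) ^ ((5 : ℝ) * ((m : ℝ) + 1) / 2) := by positivity
        have hx2 : 0 ≤ X 0 ((m : ℤ) + 1) τ ^ 2 := sq_nonneg _
        nlinarith [mul_nonneg hΛ (mul_nonneg hx2 hPs)]
      calc _ ≤ _ := hmono
        _ ≤ _ := hout
        _ ≤ E₀ * ((1 + r)⁻¹) ^ m := hflux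
        _ = _ := heq
  -- the shell sums: `Σ_i ½X_{i,k}(t)² ≤ E₀ (1+r)² q^k`
  have hshell : ∑ j : Fin 4, (1 / 2 : ℝ) * X j (k : ℤ) t ^ 2 ≤ E₀ * (1 + r) ^ 2 * ((1 + r)⁻¹) ^ k := by
    cases k with
    | zero =>
      have h := kpProper_lowEnergy_le hs hc hO hD hb0 hν.le hX0 hXneg hXc hXd hXpos 0 t ht
      rw [Finset.range_one, Finset.sum_singleton] at h
      have h1 : E₀ ≤ E₀ * (1 + r) ^ 2 * ((1 + r)⁻¹) ^ 0 := by
        rw [pow_zero, mul_one]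
        nlinarith [one_le_pow₀ (n := 2) (show (1 : ℝ) ≤ 1 + r by linarith [hr0, show (0:ℝ) ≤ r by positivity])]
      exact h.trans h1
    | succ m =>
      have hband := kpProper_bandEnergy_le_gateFlux hs hc hO hD hb0 hν.le hX0 hXneg hXc hXd hXpos
        (m := m) (N := m + 1) (by omega) t ht
      rw [Finset.Icc_self, Finset.sum_singleton] at hband
      simp only [leakSpray_gateFlux hW] at hband
      have heq : E₀ * (1 + r) * ((1 + r)⁻¹) ^ m = E₀ * (1 + r) ^ 2 * ((1 + r)⁻¹) ^ (m + 1) := by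
        rw [pow_succ ((1 + r)⁻¹) m, show E₀ * (1 + r) ^ 2 * (((1 + r)⁻¹) ^ m * (1 + r)⁻¹) =
          E₀ * (1 + r) * ((1 + r)⁻¹) ^ m * ((1 + r) * (1 + r)⁻¹) by ring, hq1, mul_one]
      calc ∑ j : Fin 4, (1 / 2 : ℝ) * X j ((m + 1 : ℕ) : ℤ) t ^ 2 ≤ _ := hband
        _ ≤ E₀ * (1 + r) * ((1 + r)⁻¹) ^ m := hgate m
        _ = _ := heq
  have hsingle : (1 / 2 : ℝ) * X i (k : ℤ) t ^ 2 ≤ ∑ j : Fin 4, (1 / 2 : ℝ) * X j (k : ℤ) t ^ 2 :=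
    Finset.single_le_sum (f := fun j => (1 / 2 : ℝ) * X j (k : ℤ) t ^ 2) (fun j _ => by positivity)
      (Finset.mem_univ i)
  have hweight : (1 + ε₀) ^ (2 * θ * (k : ℝ)) = (1 + r) ^ k := by
    rw [Real.rpow_mul hb0.le, hpow, Real.rpow_natCast]
  rw [hweight]
  calc (1 + r) ^ k * ((1 / 2 : ℝ) * X i (k : ℤ) t ^ 2) ≤ (1 + r) ^ k * (E₀ * (1 + r) ^ 2 * ((1 + r)⁻¹) ^ k) :=
        mul_le_mul_of_nonneg_left (hsingle.trans hshell) (pow_nonneg hr0.le k)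
    _ = (1 + r) ^ 2 * E₀ := by
        rw [show (1 + r) ^ k * (E₀ * (1 + r) ^ 2 * ((1 + r)⁻¹) ^ k) =
          (1 + r) ^ 2 * E₀ * ((1 + r) * (1 + r)⁻¹) ^ k by rw [mul_pow]; ring, hq1, one_pow, mul_one]

/-- **Tail ceiling** for the exit-spray class with `Σ_{e≠0}(W e² + P e²) > ε₀W 0²` (`CeilingAt R ε₀ α`, by the landed glue
`subOnsagerCeiling_ceilingAt_of_shellBarrierAt`). MODEL lattice statement. [cite: Tao2016AveragedNS, §4 (4.13)] -/
theorem exitSpray_ceilingAt {α : Fin 4 → Fin 4 → Fin 4 → ℤ × ℤ × ℤ → ℝ} {W P : Fin 4 → ℝ} {ε₀ : ℝ}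
    (hε : 0 < ε₀) (hW0 : 0 < W 0) (hWnn : ∀ i, 0 ≤ W i) (hPnn : ∀ i, 0 ≤ P i) (hgap : ε₀ * W 0 ^ 2 < W 1 ^ 2 + W 2 ^ 2 + W 3 ^ 2 + P 1 ^ 2 + P 2 ^ 2 + P 3 ^ 2)
    (hD : ∀ a b i : Fin 4, a ≠ b → α a b i (0, 0, 1) = 0)
    (hW : ∀ a i : Fin 4, α a a i (0, 0, 1) = if a = 0 then W i else 0)
    (hP : ∀ a c : Fin 4, a ≠ c → α a a c (0, 0, 0) = if a = 0 then P c else 0) (hP0 : P 0 = 0)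
    (hCz : ∀ a b c : Fin 4, a ≠ b → a ≠ c → b ≠ c → α a b c (0, 0, 0) = 0) (R : ℝ) :
    CeilingAt R ε₀ α :=
  subOnsagerCeiling_ceilingAt_of_shellBarrierAt hε (exitSpray_shellBarrierAt hε hW0 hWnn hPnn hgap hD hW hP hP0 hCz R)

/-- **The registered stubs' currency**: the body of the skeleton's `PrimaryGradedAt R ε₀ α` (verbatim) for every
exit-spray network with `Σ_{e≠0}(W e² + P e²) > ε₀W 0²`, at every scale ratio (grading `lev ≡ 0`, by
`kpPrimaryGraded_of_shellBarrierAt`). MODEL lattice statement; a corner of BOTH registered stubs, not the stubs.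
[cite: Tao2016AveragedNS, §4 (4.13)] -/
theorem exitSpray_primaryGraded {α : Fin 4 → Fin 4 → Fin 4 → ℤ × ℤ × ℤ → ℝ} {W P : Fin 4 → ℝ} {ε₀ : ℝ}
    (hε : 0 < ε₀) (hW0 : 0 < W 0) (hWnn : ∀ i, 0 ≤ W i) (hPnn : ∀ i, 0 ≤ P i) (hgap : ε₀ * W 0 ^ 2 < W 1 ^ 2 + W 2 ^ 2 + W 3 ^ 2 + P 1 ^ 2 + P 2 ^ 2 + P 3 ^ 2)
    (hD : ∀ a b i : Fin 4, a ≠ b → α a b i (0, 0, 1) = 0)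
    (hW : ∀ a i : Fin 4, α a a i (0, 0, 1) = if a = 0 then W i else 0)
    (hP : ∀ a c : Fin 4, a ≠ c → α a a c (0, 0, 0) = if a = 0 then P c else 0) (hP0 : P 0 = 0)
    (hCz : ∀ a b c : Fin 4, a ≠ b → a ≠ c → b ≠ c → α a b c (0, 0, 0) = 0) (R : ℝ) :
    Literature.Analysis.FluidPDE.TaoCascade.InTableClass R α →
      (∀ (Y : Fin 4 → ℤ → ℝ → ℝ) (τ : ℝ), (∀ (j : Fin 4) (k : ℤ), 1 ≤ k → 0 ≤ Y j k τ) → ∀ δ : ℝ, 0 < δ →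
        ∀ (i : Fin 4) (n : ℤ), 1 ≤ n → Y i n τ = 0 → 0 ≤ Literature.Analysis.FluidPDE.TaoCascade.quadTerm δ α Y i n τ) →
      (∀ a b i : Fin 4, a ≠ b → α a b i (0, 0, 1) = 0) →
      ∃ (lev : Fin 4 → ℕ) (L : ℕ), (∀ a, lev a ≤ L) ∧
        (∀ a, lev a ≠ 0 → (∃ e, α a a e (0, 0, 1) ≠ 0) →
          (∀ j, α j j a (0, 0, 1) ≠ 0 → lev j < lev a ∧ (lev j = 0 ∨ ∃ e', α j j e' (0, 0, 1) ≠ 0)) ∧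
          (∀ i₁ i₂, i₁ ≠ a → i₂ ≠ a → α i₁ i₂ a (0, 0, 0) ≠ 0 →
            (lev i₁ < lev a ∧ (lev i₁ = 0 ∨ ∃ e', α i₁ i₁ e' (0, 0, 1) ≠ 0)) ∧
            (lev i₂ < lev a ∧ (lev i₂ = 0 ∨ ∃ e', α i₂ i₂ e' (0, 0, 1) ≠ 0))) ∧
          (∃ e, α a a e (0, 0, 1) ≠ 0 ∧
            (∀ j, α e e j (0, 0, 1) ≠ 0 → lev j < lev a ∧ (lev j = 0 ∨ ∃ e', α j j e' (0, 0, 1) ≠ 0)) ∧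
            (∀ j, j ≠ e → α e e j (0, 0, 0) ≠ 0 →
              lev j < lev a ∧ (lev j = 0 ∨ ∃ e', α j j e' (0, 0, 1) ≠ 0)))) ∧
        ∃ θ : ℝ, 1 / 2 < θ ∧ θ ≤ 1 ∧ ∃ D : ℝ, 0 ≤ D ∧
          ∀ ν : ℝ, 0 < ν → ∀ (X₀ : Fin 4 → ℝ) (s : ℝ), 0 < s → ∀ X : Fin 4 → ℤ → ℝ → ℝ,
          (∀ (i : Fin 4) (k : ℤ), X i k 0 = if k = 0 then X₀ i else 0) →
          (∀ (i : Fin 4) (k : ℤ), k < 0 → ∀ t : ℝ, X i k t = 0) →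
          (∃ M : ℝ, ∀ (t : ℝ) (i : Fin 4) (k : ℤ), (1 + (1 + ε₀) ^ ((10 : ℝ) * k)) * |X i k t| ≤ M) →
          (∀ (i : Fin 4) (k : ℤ), Continuous (X i k)) →
          (∀ (i : Fin 4) (k : ℤ), ∀ t ∈ Set.Icc (0 : ℝ) s, HasDerivWithinAt (X i k)
            (Literature.Analysis.FluidPDE.TaoCascade.quadTerm ε₀ α X i k t - ν * (1 + ε₀) ^ ((2 : ℝ) * k) * X i k t)
            (Set.Icc (0 : ℝ) s) t) →
          (∀ t ∈ Set.Icc (0 : ℝ) s, ∀ (i : Fin 4) (k : ℤ), 1 ≤ k → 0 ≤ X i k t) →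
          ∀ t ∈ Set.Icc (0 : ℝ) s, ∀ i, lev i = 0 → ∀ k : ℕ,
            (1 + ε₀) ^ (2 * θ * (k : ℝ)) * ((1 / 2 : ℝ) * X i (k : ℤ) t ^ 2) ≤
              D * (∑ j : Fin 4, (1 / 2 : ℝ) * X₀ j ^ 2) :=
  kpPrimaryGraded_of_shellBarrierAt hε (exitSpray_shellBarrierAt hε hW0 hWnn hPnn hgap hD hW hP hP0 hCz R)

end Summit.NavierStokesRegularity.NavierStokesRegularity.Theorems

end
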